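import Literature.Probability.RandomPlanarGeometry.SelfAvoidingWalk
import Mathlib.Analysis.SpecialFunctions.Trigonometric.Basic
import Mathlib.Analysis.SpecialFunctions.Exp
import Mathlib.Analysis.SpecificLimits.Normed
import HarnessLib

/-!
# The end-to-end partition function of the critical SAW in a strip of `ℤ²`; the rectangle kernel

Topic `Literature/Probability/RandomPlanarGeometry`; a leaf next to `SelfAvoidingWalk.lean`
(`SAW.criticalFugacity = x_c = 1/μ(ℤ²)`, `SAW.count`). Requested by route `SAWTowerCount` of
`CriticalPhenomena/SAWScalingLimit` (idea card `count-the-tower`: the column transfer operator of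
one self-avoiding walk running along a strip of `n` rows of `ℤ²`), whose lattice statements
(`LevelTwoSolitude`, `CorridorCovariance`, `CorridorMassFiveEighths`, `RealTop`) all inline the two
objects defined here:

* `SAW.stripPartitionFunction n ℓ i j = Z_{n,ℓ}(i, j) = ∑_ω x_c^{|ω|}`, the sum over all
  self-avoiding walks `ω` of `ℤ²` from `(0, i)` to `(ℓ, j)` all of whose vertices lie in the box
  `{0, …, ℓ} × {1, …, n}` (the piece of length `ℓ` of the strip of width `n`), each weighted by the
  critical fugacity to the number of steps. This is the total mass of the Lawler–Schramm–Werner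
  measure `μ_SAW(ω) = β^{-|ω|}` (`β = μ` the connective constant, LSW 2004 §3.1) restricted to the
  walks joining two boundary points of a lattice domain (LSW 2004 §3.4.2, the boundary-to-boundary
  case `z, w ∈ ∂D`), for the lattice rectangle. It is organised by the number of steps `s`:
  `Z = ∑_s x_c^s · #(stripSAWs n ℓ s (0,i) (ℓ,j))`, where `stripSAWs` filters Mathlib's
  `SimpleGraph.finsetWalkLength s` of the nearest-neighbour graph `zdGraph 2` by
  `SimpleGraph.Walk.IsPath` and the box constraint; an `s`-step self-avoiding walk in the box has
  `s + 1 ≤ (ℓ + 1) n` distinct vertices, so the finite sum over `s < (ℓ + 1) n + 1` used in the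
  definition loses nothing (`stripSAWs_eq_empty`, `stripPartitionFunction_eq_sum_range`,
  `stripPartitionFunction_eq_tsum`).
* `rectanglePoissonKernel m y y' = ∑_{k ≥ 1} k sin(kπy) sin(kπy') / sinh(kπm)`, the eigenfunction
  expansion (separation of variables) of the boundary Poisson ("excursion") kernel of the rectangle
  `R_m = (0, m) × (0, 1)` between the boundary points `(0, y)` and `(m, y')` on its two vertical
  sides: with `G_R` the Dirichlet Green function normalised by `-Δ G_R(·, w) = δ_w`, one has
  `G_R = ∑_k 2 sin(kπy) sin(kπy') sinh(kπ x_<) sinh(kπ(m - x_>)) / (kπ sinh(kπm))` and hence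
  `∂_{n_z} ∂_{n_w} G_R((0,y), (m,y')) = 2π · rectanglePoissonKernel m y y'`. The route compares
  `Z_{n,⌊mn⌋}(i, j)` with `rectanglePoissonKernel m (i/n) (j/n)` to the power `5/8` (LSW 2004
  §3.4.3: boundary conformal weight `a = 5/8`). The series converges absolutely for `m > 0`
  (`summable_rectanglePoissonKernel`), the terms being `O(k e^{-kπm})`.

## Design choices

* The box constraint is written coordinate-wise, `0 ≤ v 0 ∧ v 0 ≤ ℓ ∧ 1 ≤ v 1 ∧ v 1 ≤ n` for
  `v : Site 2 = Fin 2 → ℤ`, literally as the route inlines it (`stripPartitionFunction_eq` is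
  `rfl`); the same box as a `Finset (Site 2)` is `stripBox n ℓ` (`mem_stripBox`, `card_stripBox`).
* Endpoints `![0, i]` (left column) and `![ℓ, j]` (right column); rows are `1, …, n`. Junk: if
  `i ∉ {1, …, n}` there is no admissible walk and `Z = 0` (`stripPartitionFunction_eq_zero_of_row`).
* Values in `ℝ` (the weights `x_c^s` are real; `0 < x_c ≤ 1/2` is in `SelfAvoidingWalkProofs`).
* `rectanglePoissonKernel` carries no normalising constant (the route uses it only up to a
  multiplicative constant and through ratios); it is indexed by `k : ℕ` with `k + 1` in the
  summand so that no `k = 0` junk term appears.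
* Mathlib has walks, paths and `finsetWalkLength` but no strip/transfer-matrix SAW objects; the
  tree's `SAWStripTM*.lean` (Jensen's bridge transfer matrix, executable) and `HexSAWStrip.lean`
  (honeycomb strip of Duminil-Copin–Smirnov) are different objects (searched `stripPartition`,
  `PoissonKernel`, `finsetWalkLength`).

## References

* G. F. Lawler, O. Schramm, W. Werner, *On the scaling limit of planar self-avoiding walk*,
  Proc. Sympos. Pure Math. 72, Part 2 (2004), 339–364 (arXiv:math/0204277): §3.1 (the measure
  `μ_SAW(ω) = β^{-|ω|}`), §3.4.2 (walks between two boundary points of a lattice domain and the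
  total mass of `μ_SAW` on them), §3.4.3 (conformal covariance, boundary exponent `a`).
* B. Derrida, *Phenomenological renormalisation of the self avoiding walk in two dimensions*,
  J. Phys. A 14 (1981) L5–L9 (SAW transfer matrices in strips of `ℤ²`).
-/

noncomputable section

open Finset Literature.Probability.LatticeModels
open scoped Real

namespace Literature.Probability.RandomPlanarGeometry

namespace SAW

/-! ### The box `{0, …, ℓ} × {1, …, n}` and the self-avoiding walks inside it -/

/-- The vertex set `{0, …, ℓ} × {1, …, n} ⊆ ℤ²` of the length-`ℓ` piece of the strip of width
`n` (columns `0, …, ℓ`, rows `1, …, n`), as a finite set of sites. [folklore] -/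
def stripBox (n ℓ : ℕ) : Finset (Site 2) :=
  (Icc (0 : ℤ) ℓ ×ˢ Icc (1 : ℤ) n).image fun q => ![q.1, q.2]

/-- Membership in `stripBox` is the coordinate-wise box constraint used by the route.
[folklore] -/
theorem mem_stripBox {n ℓ : ℕ} {v : Site 2} :
    v ∈ stripBox n ℓ ↔ 0 ≤ v 0 ∧ v 0 ≤ ℓ ∧ 1 ≤ v 1 ∧ v 1 ≤ n := by
  simp only [stripBox, mem_image, mem_product, mem_Icc, Prod.exists]
  constructor
  · rintro ⟨a, b, ⟨⟨ha0, haℓ⟩, hb1, hbn⟩, rfl⟩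
    simpa using ⟨ha0, haℓ, hb1, hbn⟩
  · rintro ⟨h0, hℓ, h1, hn⟩
    refine ⟨v 0, v 1, ⟨⟨h0, hℓ⟩, h1, hn⟩, ?_⟩
    ext i
    fin_cases i <;> simp

/-- The box has `(ℓ + 1) · n` vertices. [folklore] -/
theorem card_stripBox (n ℓ : ℕ) : (stripBox n ℓ).card = (ℓ + 1) * n := by
  have hinj : Function.Injective fun q : ℤ × ℤ => (![q.1, q.2] : Site 2) := by
    intro q q' h
    have h0 := congrFun h 0
    have h1 := congrFun h 1
    simp only [Matrix.cons_val_zero, Matrix.cons_val_one] at h0 h1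
    exact Prod.ext h0 h1
  rw [stripBox, card_image_of_injective _ hinj, card_product, Int.card_Icc, Int.card_Icc]
  have h1 : ((ℓ : ℤ) + 1 - 0).toNat = ℓ + 1 := by omega
  have h2 : ((n : ℤ) + 1 - 1).toNat = n := by omega
  rw [h1, h2]

/-- `stripSAWs n ℓ s a b`: the `s`-step self-avoiding walks of `ℤ²` (walks of `zdGraph 2` that are
paths, `SimpleGraph.Walk.IsPath`) from `a` to `b` all of whose vertices `v` satisfy
`0 ≤ v 0 ≤ ℓ` and `1 ≤ v 1 ≤ n`, as a finite set (a filter of Mathlib's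
`SimpleGraph.finsetWalkLength s a b`): the lattice-rectangle instance (vertices in the closed box,
endpoints typically on its two vertical sides) of LSW's self-avoiding walks joining two boundary
points of a domain, graded by the number of steps. [cite: LawlerSchrammWerner2004SAW, §3.4.2] -/
def stripSAWs (n ℓ s : ℕ) (a b : Site 2) : Finset ((zdGraph 2).Walk a b) :=
  ((zdGraph 2).finsetWalkLength s a b).filter
    fun p => p.IsPath ∧ ∀ v ∈ p.support, 0 ≤ v 0 ∧ v 0 ≤ ℓ ∧ 1 ≤ v 1 ∧ v 1 ≤ n

/-- Unfolding `stripSAWs`: length `s`, self-avoiding, inside the box. [folklore] -/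
theorem mem_stripSAWs {n ℓ s : ℕ} {a b : Site 2} {p : (zdGraph 2).Walk a b} :
    p ∈ stripSAWs n ℓ s a b ↔ p.length = s ∧ p.IsPath ∧ ∀ v ∈ p.support, v ∈ stripBox n ℓ := by
  simp only [stripSAWs, mem_filter, SimpleGraph.mem_finsetWalkLength_iff, mem_stripBox]

/-- Pigeonhole: a self-avoiding walk inside the box has fewer steps than the box has vertices,
`s < (ℓ + 1) n`. [folklore] -/
theorem lt_of_mem_stripSAWs {n ℓ s : ℕ} {a b : Site 2} {p : (zdGraph 2).Walk a b}
    (hp : p ∈ stripSAWs n ℓ s a b) : s < (ℓ + 1) * n := by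
  obtain ⟨hlen, hpath, hbox⟩ := mem_stripSAWs.1 hp
  have hsub : p.support.toFinset ⊆ stripBox n ℓ := fun v hv => hbox v (List.mem_toFinset.1 hv)
  have hcard := card_le_card hsub
  rw [List.toFinset_card_of_nodup hpath.support_nodup, SimpleGraph.Walk.length_support,
    card_stripBox, hlen] at hcard
  omega

/-- There are no self-avoiding walks with `s ≥ (ℓ + 1) n` steps inside the box. [folklore] -/
theorem stripSAWs_eq_empty {n ℓ s : ℕ} (hs : (ℓ + 1) * n ≤ s) (a b : Site 2) :
    stripSAWs n ℓ s a b = ∅ :=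
  eq_empty_of_forall_notMem fun _ hp => absurd (lt_of_mem_stripSAWs hp) (not_lt.2 hs)

/-- If the starting row `a 1` is not in `{1, …, n}` (or the starting column is not in
`{0, …, ℓ}`), there is no admissible walk at all. [folklore] -/
theorem stripSAWs_eq_empty_of_start {n ℓ : ℕ} {a : Site 2}
    (ha : ¬(0 ≤ a 0 ∧ a 0 ≤ ℓ ∧ 1 ≤ a 1 ∧ a 1 ≤ n)) (s : ℕ) (b : Site 2) :
    stripSAWs n ℓ s a b = ∅ :=
  eq_empty_of_forall_notMem fun p hp =>
    ha (mem_stripBox.1 ((mem_stripSAWs.1 hp).2.2 a p.start_mem_support))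

/-! ### The partition function -/

/-- **The end-to-end partition function of the critical SAW in the strip**:
`Z_{n,ℓ}(i, j) = ∑_ω x_c^{|ω|}`, summed over all self-avoiding walks `ω` of `ℤ²` from `(0, i)` to
`(ℓ, j)` with every vertex in `{0, …, ℓ} × {1, …, n}`, `x_c = SAW.criticalFugacity = 1/μ(ℤ²)`;
i.e. the total mass of the Lawler–Schramm–Werner measure `μ_SAW(ω) = μ^{-|ω|}` (§3.1) restricted
to the walks inside the lattice rectangle joining the two boundary vertices `(0, i)`, `(ℓ, j)` (the
boundary-to-boundary case of §3.4.2, here with the closed box as the lattice domain). Written as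
the finite sum over the number of steps `s ≤ (ℓ + 1) n` (no admissible walk is longer,
`stripSAWs_eq_empty`); `= 0` if `i ∉ {1, …, n}` or `j ∉ {1, …, n}`.
[cite: LawlerSchrammWerner2004SAW, §3.1 and §3.4.2] -/
def stripPartitionFunction (n ℓ : ℕ) (i j : ℤ) : ℝ :=
  ∑ s ∈ range ((ℓ + 1) * n + 1),
    criticalFugacity ^ s * ((stripSAWs n ℓ s ![0, i] ![ℓ, j]).card : ℝ)

/-- `stripPartitionFunction` with everything inlined, literally the term the route
`SAWTowerCount` abbreviates as `Z n ℓ i j` (definitional, `rfl`).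
[cite: LawlerSchrammWerner2004SAW, §3.4.2] -/
theorem stripPartitionFunction_eq (n ℓ : ℕ) (i j : ℤ) :
    stripPartitionFunction n ℓ i j =
      ∑ s ∈ range ((ℓ + 1) * n + 1), criticalFugacity ^ s *
        ((((zdGraph 2).finsetWalkLength s ![0, i] ![(ℓ : ℤ), j]).filter fun p =>
          p.IsPath ∧ ∀ v ∈ p.support,
            (0 : ℤ) ≤ v 0 ∧ v 0 ≤ (ℓ : ℤ) ∧ (1 : ℤ) ≤ v 1 ∧ v 1 ≤ (n : ℤ)).card : ℝ) :=
  rfl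

/-- The critical fugacity is nonnegative (`μ` is an infimum of nonnegative reals); local copy of
the unconditional `0 < x_c` of `SelfAvoidingWalkProofs` / `SAWBridgeRadius`, kept here to keep the
imports of this leaf minimal. [folklore] -/
private theorem criticalFugacity_nonneg' : 0 ≤ criticalFugacity := by
  rw [criticalFugacity, inv_nonneg, connectiveConstant]
  exact Real.iInf_nonneg fun n => Real.rpow_nonneg (Nat.cast_nonneg _) _

/-- `Z_{n,ℓ}(i, j) ≥ 0`. [folklore] -/
theorem stripPartitionFunction_nonneg (n ℓ : ℕ) (i j : ℤ) : 0 ≤ stripPartitionFunction n ℓ i j :=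
  sum_nonneg fun s _ => mul_nonneg (pow_nonneg criticalFugacity_nonneg' s) (Nat.cast_nonneg _)

/-- The cutoff in the number of steps is immaterial: for every `N ≥ (ℓ + 1) n + 1` the same sum
over `s < N` gives `Z_{n,ℓ}(i, j)`. [folklore] -/
theorem stripPartitionFunction_eq_sum_range {n ℓ N : ℕ} (hN : (ℓ + 1) * n + 1 ≤ N) (i j : ℤ) :
    stripPartitionFunction n ℓ i j =
      ∑ s ∈ range N, criticalFugacity ^ s * ((stripSAWs n ℓ s ![0, i] ![ℓ, j]).card : ℝ) := by
  refine sum_subset (fun s hs => mem_range.2 ((mem_range.1 hs).trans_le hN)) fun s _ hs => ?_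
  have hs' : (ℓ + 1) * n ≤ s := by rw [mem_range, not_lt] at hs; omega
  rw [stripSAWs_eq_empty hs', card_empty, Nat.cast_zero, mul_zero]

/-- `Z_{n,ℓ}(i, j) = ∑_{s ≥ 0} x_c^s · #{s-step SAWs from (0,i) to (ℓ,j) in the box}` as an
unrestricted series (all terms with `s ≥ (ℓ + 1) n` vanish). [cite: LawlerSchrammWerner2004SAW, §3.4.2] -/
theorem stripPartitionFunction_eq_tsum (n ℓ : ℕ) (i j : ℤ) :
    stripPartitionFunction n ℓ i j =
      ∑' s : ℕ, criticalFugacity ^ s * ((stripSAWs n ℓ s ![0, i] ![ℓ, j]).card : ℝ) := by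
  rw [stripPartitionFunction, eq_comm]
  refine tsum_eq_sum fun s hs => ?_
  have hs' : (ℓ + 1) * n ≤ s := by rw [mem_range, not_lt] at hs; omega
  rw [stripSAWs_eq_empty hs', card_empty, Nat.cast_zero, mul_zero]

/-- Junk value: if the starting row `i` is not in `{1, …, n}` then `Z_{n,ℓ}(i, j) = 0`.
[folklore] -/
theorem stripPartitionFunction_eq_zero_of_row {n ℓ : ℕ} {i : ℤ} (hi : ¬(1 ≤ i ∧ i ≤ n)) (j : ℤ) :
    stripPartitionFunction n ℓ i j = 0 := by
  refine sum_eq_zero fun s _ => ?_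
  rw [stripSAWs_eq_empty_of_start (fun h => hi (by simpa using h.2.2)) s, card_empty,
    Nat.cast_zero, mul_zero]

/-- Sanity check of the normalisation: in the `1 × 1` box the only walk from `(0, 1)` to itself is
the trivial one, of weight `x_c^0 = 1`, so `Z_{1,0}(1, 1) = 1`. [folklore] -/
theorem stripPartitionFunction_one_zero : stripPartitionFunction 1 0 1 1 = 1 := by
  have h0 : (stripSAWs 1 0 0 ![0, 1] ![((0 : ℕ) : ℤ), 1]).card = 1 := by
    rw [card_eq_one]
    refine ⟨SimpleGraph.Walk.nil, ?_⟩
    ext p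
    rw [mem_stripSAWs, mem_singleton, SimpleGraph.Walk.length_eq_zero_iff,
      ← SimpleGraph.Walk.eq_nil_iff_nil]
    constructor
    · rintro ⟨rfl, -, -⟩; rfl
    · rintro rfl
      refine ⟨rfl, SimpleGraph.Walk.IsPath.nil, fun v hv => ?_⟩
      rw [SimpleGraph.Walk.support_nil, List.mem_singleton] at hv
      subst hv
      simp [mem_stripBox]
  have h1 : (stripSAWs 1 0 1 ![0, 1] ![((0 : ℕ) : ℤ), 1]).card = 0 := by
    rw [card_eq_zero]
    refine eq_empty_of_forall_notMem fun p hp => ?_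
    obtain ⟨hlen, hpath, -⟩ := mem_stripSAWs.1 hp
    obtain rfl := SimpleGraph.Walk.eq_nil_iff_nil.2 (SimpleGraph.Walk.isPath_iff_nil.1 hpath)
    simp at hlen
  simp only [stripPartitionFunction, zero_add, one_mul, sum_range_succ, sum_range_zero, pow_zero,
    pow_one]
  rw [h0, h1]
  simp

end SAW

/-! ### The rectangle kernel -/

/-- **The boundary Poisson (excursion) kernel of the rectangle `(0, m) × (0, 1)` between the points
`(0, y)` and `(m, y')` of its vertical sides**, as the eigenfunction series
`∑_{k ≥ 1} k sin(kπy) sin(kπy') / sinh(kπm)` (indexed by `k + 1`, `k : ℕ`), without normalising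
constant: for the Dirichlet Green function `G` of the rectangle with `-ΔG(·, w) = δ_w`,
separation of variables gives `∂_{n_z}∂_{n_w} G((0,y),(m,y')) = 2π ·` this series. Absolutely
convergent for `m > 0` (`summable_rectanglePoissonKernel`); Mathlib's junk value `0` of `tsum`
otherwise. [folklore] -/
def rectanglePoissonKernel (m y y' : ℝ) : ℝ :=
  ∑' k : ℕ, ((k : ℝ) + 1) * Real.sin (((k : ℝ) + 1) * π * y) * Real.sin (((k : ℝ) + 1) * π * y') /
    Real.sinh (((k : ℝ) + 1) * π * m)

/-- The kernel is symmetric in the two boundary heights. [folklore] -/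
theorem rectanglePoissonKernel_symm (m y y' : ℝ) :
    rectanglePoissonKernel m y y' = rectanglePoissonKernel m y' y := by
  unfold rectanglePoissonKernel
  exact tsum_congr fun k => by ring

/-- The kernel vanishes at the corner `y = 0` (Dirichlet boundary values). [folklore] -/
theorem rectanglePoissonKernel_zero_left (m y' : ℝ) : rectanglePoissonKernel m 0 y' = 0 := by
  simp [rectanglePoissonKernel]

/-- The kernel vanishes at the corner `y = 1` (`sin(kπ) = 0`). [folklore] -/
theorem rectanglePoissonKernel_one_left (m y' : ℝ) : rectanglePoissonKernel m 1 y' = 0 := by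
  have h : ∀ k : ℕ, Real.sin (((k : ℝ) + 1) * π) = 0 := fun k => by
    exact_mod_cast Real.sin_nat_mul_pi (k + 1)
  simp [rectanglePoissonKernel, h]

/-- A lower bound for `sinh` past a positive threshold: `sinh t ≥ ½(1 - e^{-2t₀}) eᵗ` for
`t ≥ t₀`. [folklore] -/
private theorem sinh_ge_of_le {t₀ t : ℝ} (ht : t₀ ≤ t) :
    (1 - Real.exp (-(2 * t₀))) / 2 * Real.exp t ≤ Real.sinh t := by
  rw [Real.sinh_eq]
  have h1 : Real.exp (-t) = Real.exp t * Real.exp (-(2 * t)) := by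
    rw [← Real.exp_add]; ring_nf
  have h2 : Real.exp (-(2 * t)) ≤ Real.exp (-(2 * t₀)) := Real.exp_le_exp.2 (by linarith)
  have h3 : 0 < Real.exp t := Real.exp_pos t
  rw [h1]
  nlinarith [mul_le_mul_of_nonneg_left h2 h3.le]

/-- For `m > 0` the eigenfunction series defining `rectanglePoissonKernel m y y'` converges
absolutely: its `k`-th term is at most `(k+1)/sinh((k+1)πm) = O((k+1) e^{-(k+1)πm})`.
[folklore] -/
theorem summable_rectanglePoissonKernel {m : ℝ} (hm : 0 < m) (y y' : ℝ) :
    Summable fun k : ℕ => ((k : ℝ) + 1) * Real.sin (((k : ℝ) + 1) * π * y) *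
      Real.sin (((k : ℝ) + 1) * π * y') / Real.sinh (((k : ℝ) + 1) * π * m) := by
  have hπm : 0 < π * m := mul_pos Real.pi_pos hm
  set c : ℝ := (1 - Real.exp (-(2 * (π * m)))) / 2 with hc_def
  have hc : 0 < c := by
    have : Real.exp (-(2 * (π * m))) < 1 := Real.exp_lt_one_iff.2 (by linarith)
    rw [hc_def]; linarith
  -- the comparison series `(k+1) e^{-(πm)(k+1)} / c`
  have hg : Summable fun k : ℕ =>
      ((((k + 1 : ℕ) : ℝ) ^ 1 * Real.exp (-(π * m) * ((k + 1 : ℕ) : ℝ))) / c) := by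
    have h := (Real.summable_pow_mul_exp_neg_nat_mul 1 hπm).comp_injective
      (add_left_injective 1)
    exact h.div_const c
  refine Summable.of_norm (Summable.of_nonneg_of_le (fun k => norm_nonneg _) (fun k => ?_) hg)
  have hk : (0 : ℝ) < (k : ℝ) + 1 := by positivity
  set t : ℝ := ((k : ℝ) + 1) * π * m with ht_def
  have ht : π * m ≤ t := by rw [ht_def]; nlinarith [hπm.le, (Nat.cast_nonneg k : (0 : ℝ) ≤ k)]
  have hsinh : c * Real.exp t ≤ Real.sinh t := by rw [hc_def]; exact sinh_ge_of_le ht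
  have hct : 0 < c * Real.exp t := mul_pos hc (Real.exp_pos t)
  have hs_pos : 0 < Real.sinh t := hct.trans_le hsinh
  -- `‖term‖ ≤ (k+1)/sinh t ≤ (k+1)/(c eᵗ) = (k+1) e^{-t} / c`
  have hbound : ‖((k : ℝ) + 1) * Real.sin (((k : ℝ) + 1) * π * y) *
      Real.sin (((k : ℝ) + 1) * π * y') / Real.sinh t‖ ≤ ((k : ℝ) + 1) / Real.sinh t := by
    rw [Real.norm_eq_abs, abs_div, abs_of_pos hs_pos, abs_mul, abs_mul, abs_of_pos hk]
    gcongr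
    calc ((k : ℝ) + 1) * |Real.sin (((k : ℝ) + 1) * π * y)| * |Real.sin (((k : ℝ) + 1) * π * y')|
        ≤ ((k : ℝ) + 1) * 1 * 1 := by
          gcongr
          · exact Real.abs_sin_le_one _
          · exact Real.abs_sin_le_one _
      _ = (k : ℝ) + 1 := by ring
  refine hbound.trans ?_
  calc ((k : ℝ) + 1) / Real.sinh t ≤ ((k : ℝ) + 1) / (c * Real.exp t) :=
        div_le_div_of_nonneg_left hk.le hct hsinh
    _ = (((k + 1 : ℕ) : ℝ) ^ 1 * Real.exp (-(π * m) * ((k + 1 : ℕ) : ℝ))) / c := by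
        rw [pow_one, Nat.cast_add, Nat.cast_one]
        have : -(π * m) * ((k : ℝ) + 1) = -t := by rw [ht_def]; ring
        rw [this, Real.exp_neg]
        field_simp

end Literature.Probability.RandomPlanarGeometry
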